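import Summits.ResolutionOfSingularities.ResolutionOfSingularities.Theorems.HomologicalConductorNoZenoRExcCurveToAffine
import Summits.ResolutionOfSingularities.ResolutionOfSingularities.Theorems.HomologicalConductorNoZenoBaseIdealSections
import Summits.ResolutionOfSingularities.ResolutionOfSingularities.Theorems.HomologicalConductorNoZenoBaseIdealBlowupLift
import Literature.AlgebraicGeometry.Resolution.BlowupChartMembership
import Literature.AlgebraicGeometry.Resolution.StalkIdealLemmas
import Literature.AlgebraicGeometry.Resolution.IdealSheafLemmas
import HarnessLib

/-!
# Crux `NoZenoR` (stmt-ResolutionOfSingularities-19943) — over a NON-REGULAR rational surface singularity every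
# first-kind exceptional curve is CONTRACTED TO A CLOSED POINT of the quadratic transform `Bl_𝔪 Spec S`
# (steps [G2]+[G3] of the Castelnuovo-free road to Lipman (27.3)/(27.1); with [G1], [G4] already in the tree)

Route `ResolutionOfSingularities/HomologicalConductor` (cell decomp-res, hand leafhand-res-homologicalconduct-24 g0).
OURS: AI-written proof over tree theorems, weaker than expert review; nothing here is a statement of the manuscript
under review (Hironaka 2017).  SUPPORT level, counted 0.  Def-free, fact-free.

* `stalkIdeal_baseIdeal_eq_span_of_mem_nonvanishing` — dictionary: `x ∈ (−Z).nonvanishing c` (`Z` the Cartier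
  divisor of a base ideal `𝔞𝒪_X`, `c ∈ 𝔞`) ⇒ `𝔞·𝒪_{X,x} = (c)`;
* `stalkIdeal_eq_span_of_comap` — transport DOWN a morphism `σ : X → V` over `Spec S`: if `K` is an effective
  Cartier ideal on `V` with `c_v ∈ K_v` and `(σ^*K)_x = (c)` then `K_{σ x} = (c)` (`c = a·t`, `t` a local generator;
  `a` becomes a unit upstairs, and stalk maps are local);
* **`isClosed_singleton_apply_of_firstKind`** — `S` rational non-regular, `π : X → Spec S` a desingularization,
  `b : V → Spec S` a blowing up of `𝔪`, `σ : X → V` proper with `σ ≫ b = π`, `E_η` of the first kind ⇒ `σ η` is a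
  CLOSED point of `V`: one `c ∈ 𝔪` generates `𝔪𝒪_X` along `cl{η}` (`…FirstKindChartSection`), hence `𝔪𝒪_V` along
  `σ(cl{η})`, so `σ(cl{η})` lies in the affine chart `D₊(ct)` (`IsBlowup.mem_range_chart_of_stalkIdeal_eq_span`),
  and `σ` is constant on `cl{η}` (`…ExcCurveToAffine`).

What remains for «the minimal desingularization has no first-kind curve» (memo MEMO-19943-hand24g0-M0-ROAD.md):
the base change of a (minimal) desingularization to `Spec 𝒪_{V,σ η}` ([B], [U]) and the induction ([I]).
No crux or summit statement is proved here.
-/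

noncomputable section

-- single-problem summit: the doubled namespace component `ResolutionOfSingularities` is forced
set_option linter.dupNamespace false

open CategoryTheory CategoryTheory.Limits AlgebraicGeometry TopologicalSpace IsLocalRing HomogeneousLocalization
open Literature.AlgebraicGeometry Literature.AlgebraicGeometry.Resolution Literature.AlgebraicGeometry.Motives
open Literature.AlgebraicGeometry.Motives.RatFn
open Summit.ResolutionOfSingularities.ResolutionOfSingularities.Theorems.NoZeno.SandwichCluster
  (toFunctionField_germ_appTop)

namespace Summit.ResolutionOfSingularities.ResolutionOfSingularities.Theorems.NoZeno.FirstKind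

/-! ## §1 Dictionary: non-vanishing locus of `c` versus `𝔞·𝒪_{X,x} = (c)` -/

section Dictionary

variable {T : Type} [CommRing T] {X : Scheme.{0}} [IsIntegral X] (π : X ⟶ Spec (.of T)) {𝔞 : Ideal T}
  (hJ : IsEffectiveCartier (Scheme.IdealSheafData.ofIdealTop (𝔞.map (Morphisms.algebraMapΓ π))))

include hJ in
/-- **`x ∈ (−Z).nonvanishing c` ⇒ `𝔞·𝒪_{X,x} = (c)`** (`Z` the Cartier divisor of `𝔞𝒪_X`): the local equation `g`
of `Z` at `x` satisfies `c = g·u` with `u ∈ 𝒪_{X,x}^×`. [cite: GortzWedhorn2020, Remark 11.27 (p. 378)] -/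
theorem stalkIdeal_baseIdeal_eq_span_of_mem_nonvanishing {c : T} {x : X}
    (hx : x ∈ (-CartierDivisor.ofIsEffectiveCartier _ hJ).nonvanishing (baseToFunctionField π c)) :
    stalkIdeal (Scheme.IdealSheafData.ofIdealTop (𝔞.map (Morphisms.algebraMapΓ π))) x =
      Ideal.span {ExcCount.toStalk π x c} := by
  have hxU : x ∈ (CartierDivisor.cartierChart _ hJ x : X.Opens) := CartierDivisor.mem_cartierChart _ hJ x
  have h2 : stalkIdeal (Scheme.IdealSheafData.ofIdealTop (𝔞.map (Morphisms.algebraMapΓ π))) x =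
      Ideal.span {(X.presheaf.germ _ x hxU).hom (CartierDivisor.cartierGen _ hJ x)} := by
    rw [stalkIdeal_eq_map_germ _ (CartierDivisor.cartierChart _ hJ x) hxU,
      CartierDivisor.ideal_cartierChart, Ideal.map_span, Set.image_singleton]
  have hcK : baseToFunctionField π c = toFunctionField x (ExcCount.toStalk π x c) :=
    (toFunctionField_germ_appTop π x c).symm
  have hgK : (CartierDivisor.ofIsEffectiveCartier _ hJ).f x =
      toFunctionField x ((X.presheaf.germ _ x hxU).hom (CartierDivisor.cartierGen _ hJ x)) := by
    rw [CartierDivisor.ofIsEffectiveCartier_f, ← toFunctionField_germ_eq_secFn hxU hxU]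
  have hg0 : toFunctionField x ((X.presheaf.germ _ x hxU).hom (CartierDivisor.cartierGen _ hJ x)) ≠ 0 := by
    rw [← hgK]; exact (CartierDivisor.ofIsEffectiveCartier _ hJ).f_ne_zero x
  have hxU' : x ∈ (-CartierDivisor.ofIsEffectiveCartier _ hJ).U x := hxU
  rw [CartierDivisor.mem_nonvanishing_iff hxU', CartierDivisor.neg_f, hcK, hgK] at hx
  obtain ⟨u, hu⟩ := hx
  -- `u · g = c` in `𝒪_{X,x}`
  have hug : (u : X.presheaf.stalk x) * (X.presheaf.germ _ x hxU).hom (CartierDivisor.cartierGen _ hJ x) =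
      ExcCount.toStalk π x c := by
    apply toFunctionField_injective x
    rw [map_mul, hu, mul_comm, ← mul_assoc, mul_inv_cancel₀ hg0, one_mul]
  rw [h2, ← hug]
  exact (Ideal.span_singleton_mul_left_unit u.isUnit _).symm

end Dictionary

/-! ## §2 Transport of a local generator down a morphism over the base -/

section Transport

variable {X V : Scheme.{0}} [IsIntegral X] (σ : X ⟶ V)

/-- **Transport of «`c` generates» DOWN `σ`.**  `K` an effective Cartier ideal sheaf on `V`, `v = σ x`, `c_v ∈ K_v`,
and `(σ^*K)_x = (σ_x^♯ c_v)` with `(σ^*K)_x ≠ 0` (`X` integral): then `K_v = (c_v)`.  Indeed `K_v = (t)`,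
`c_v = a t`, and upstairs `(σ♯t) = (σ♯a · σ♯t)` in the domain `𝒪_{X,x}` forces `σ♯a` to be a unit, hence `a`
(stalk maps are local). [folklore] -/
theorem stalkIdeal_eq_span_of_comap {K : V.IdealSheafData} (hK : IsEffectiveCartier K) {x : X}
    {cv : V.presheaf.stalk (σ.base x)} (hcv : cv ∈ stalkIdeal K (σ.base x))
    (hx : stalkIdeal (K.comap σ) x = Ideal.span {(σ.stalkMap x).hom cv})
    (hne : stalkIdeal (K.comap σ) x ≠ ⊥) :
    stalkIdeal K (σ.base x) = Ideal.span {cv} := by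
  obtain ⟨t, -, hKt⟩ := hK.exists_stalkIdeal_eq_span (σ.base x)
  rw [hKt] at hcv ⊢
  obtain ⟨a, rfl⟩ := Ideal.mem_span_singleton'.mp hcv
  -- upstairs: `(θ t) = (θ a · θ t)`
  set θ := (σ.stalkMap x).hom with hθ
  have hup : Ideal.span {θ t} = Ideal.span {θ a * θ t} := by
    rw [← map_mul, ← hx, stalkIdeal_comap_eq_map_stalkMap, hKt, Ideal.map_span, Set.image_singleton]
  have ht0 : θ t ≠ 0 := by
    intro h0
    apply hne
    rw [stalkIdeal_comap_eq_map_stalkMap, hKt, Ideal.map_span, Set.image_singleton, ← hθ, h0,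
      Ideal.span_singleton_eq_bot]
  -- `θ t ∈ (θ a · θ t)`: `θ t = w · θ a · θ t`, so `w · θ a = 1`
  have hmem : θ t ∈ Ideal.span {θ a * θ t} := hup ▸ Ideal.mem_span_singleton_self _
  obtain ⟨w, hw⟩ := Ideal.mem_span_singleton'.mp hmem
  have hunit : IsUnit (θ a) := by
    have h1 : (w * θ a - 1) * θ t = 0 := by rw [sub_mul, one_mul, mul_assoc, hw, sub_self]
    have h2 : w * θ a - 1 = 0 := (mul_eq_zero.mp h1).resolve_right ht0
    exact isUnit_iff_exists_inv'.mpr ⟨w, by rw [sub_eq_zero] at h2; exact h2⟩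
  have ha : IsUnit a := (isUnit_map_iff (σ.stalkMap x).hom a).mp hunit
  exact (Ideal.span_singleton_mul_left_unit ha t).symm

end Transport

/-! ## §3 First-kind curves are contracted to CLOSED points of the quadratic transform -/

section Main

variable {S : Type} [CommRing S] [IsNoetherianRing S] [IsLocalRing S] [IsDomain S] [IsIntegrallyClosed S]
  {X : Scheme.{0}} [IsIntegral X] [IsLocallyNoetherian X] (π : X ⟶ Spec (.of S))

/-- **A first-kind curve is contracted to a CLOSED point of the quadratic transform.**  `S` a two-dimensional
Noetherian local normal domain with a rational singularity, NOT regular; `π : X → Spec S` a desingularization;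
`b : V → Spec S` a blowing up of `𝔪` and `σ : X → V` proper with `σ ≫ b = π` (Lipman's (*), p. 203: tree
`QuadraticTransform.exists_isResolution_fac_of_isBlowup_maximalIdeal`); `E_η` an integral exceptional curve of the
first kind.  Then `σ η` is a closed point of `V` (and `σ(cl{η}) = {σ η}`).
[cite: Lipman1969, Section 2, (*) (p. 203); Proposition (13.1) c) (p. 223); StacksProject, Tag 0804] -/
theorem isClosed_singleton_apply_of_firstKind (hdim : ringKrullDim S = 2) (hrat : HasRationalSingularity S)
    (hsing : ¬ IsRegularLocalRing S) (hπ : IsResolution π) {V : Scheme.{0}} {b : V ⟶ Spec (.of S)}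
    (hb : IsBlowup b (affineBlowup.idealSheaf (maximalIdeal S))) (σ : X ⟶ V) [IsProper σ] (hσ : σ ≫ b = π)
    {η : X} (hη : η ∈ excCurvePoints π)
    (hfk : h0 π (primeDivisorIdeal η ^ 2) = 3 * h0 π (primeDivisorIdeal η)) :
    IsClosed ({σ.base η} : Set V) := by
  haveI : IsProper π := hπ.isProper
  haveI : IsDominant π := hπ.isBirational.isDominant
  have hJ := QuadraticTransform.isEffectiveCartier_baseIdeal_maximalIdeal π hdim hrat hsing hπ
  -- [G1]: one `c ∈ 𝔪` generates `𝔪𝒪_X` along `cl{η}`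
  obtain ⟨c, hc, hgen⟩ := exists_forall_mem_nonvanishing_of_firstKind π hdim hrat hsing hπ hη hfk hJ
  -- the exceptional ideal `K = b^*𝔪̃` on `V` and its pull-back `σ^*K = 𝔪𝒪_X`
  set K := (affineBlowup.idealSheaf (maximalIdeal S)).comap b with hKdef
  have hKσ : K.comap σ = Scheme.IdealSheafData.ofIdealTop ((maximalIdeal S).map (Morphisms.algebraMapΓ π)) := by
    rw [hKdef, ← Scheme.IdealSheafData.comap_comp, hσ, ExcCount.comap_affineBlowupIdealSheaf_eq_baseIdeal]
  -- the chart of `V` belonging to `c`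
  let U : (Spec (.of S)).affineOpens := ⟨⊤, isAffineOpen_top _⟩
  have hcU : (Scheme.ΓSpecIso (.of S)).inv.hom c ∈ (affineBlowup.idealSheaf (maximalIdeal S)).ideal U := by
    change _ ∈ (Scheme.IdealSheafData.ofIdealTop _).ideal ⟨⊤, _⟩
    rw [ideal_ofIdealTop_top]
    exact Ideal.mem_map_of_mem _ hc
  obtain ⟨g, hgopen, hgπ, -⟩ := hb.exists_charts U
  haveI := hgopen ((Scheme.ΓSpecIso (.of S)).inv.hom c) hcU
  -- [G2]+[G3]: every point of `σ(cl{η})` lies on that chart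
  have hchart : σ.base '' closure {η} ⊆
      ((g _ hcU).opensRange : Set V) := by
    rintro _ ⟨x, hx, rfl⟩
    rw [Scheme.Hom.coe_opensRange]
    have hxgen : stalkIdeal (K.comap σ) x = Ideal.span {ExcCount.toStalk π x c} := by
      rw [hKσ]
      exact stalkIdeal_baseIdeal_eq_span_of_mem_nonvanishing π hJ (hgen x hx)
    -- `toStalk π x c = σ_x^♯ (toStalk b (σ x) c)`
    have hcomp : ExcCount.toStalk π x c = (σ.stalkMap x).hom (ExcCount.toStalk b (σ.base x) c) := by
      rw [ExcCount.toStalk_eq_germ_comp_algebraMapΓ, ExcCount.toStalk_eq_germ_comp_algebraMapΓ]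
      simp only [RingHom.coe_comp, Function.comp_apply]
      rw [Scheme.Hom.germ_stalkMap_apply σ ⊤ x trivial]
      change (X.presheaf.germ ⊤ x trivial).hom (π.appTop.hom _) =
        (X.presheaf.germ ⊤ x trivial).hom ((σ.app ⊤).hom (b.appTop.hom _))
      rw [← hσ]
      rfl
    have hne : stalkIdeal (K.comap σ) x ≠ ⊥ := by
      rw [hKσ, ExcCount.stalkIdeal_baseIdeal_eq_map_toStalk, Ne,
        Ideal.map_eq_bot_iff_of_injective (ExcCount.toStalk_injective π x)]
      exact QuadraticTransform.maximalIdeal_ne_bot_of_ringKrullDim_eq_two hdim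
    have hcv : ExcCount.toStalk b (σ.base x) c ∈ stalkIdeal K (σ.base x) := by
      rw [hKdef, ExcCount.stalkIdeal_comap_affineBlowupIdealSheaf]
      exact Ideal.mem_map_of_mem _ hc
    have hKv := stalkIdeal_eq_span_of_comap σ hb.isEffectiveCartier hcv (hcomp ▸ hxgen) hne
    refine hb.mem_range_chart_of_stalkIdeal_eq_span U hcU (g _ hcU) (hgπ _ hcU) (x' := σ.base x)
      (Set.mem_univ _) ?_
    rw [hKv]
    congr 1
    refine Set.singleton_eq_singleton_iff.mpr ?_
    rw [Scheme.Hom.germ_stalkMap_apply]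
    rfl
  -- [G4]: `σ` is constant on `cl{η}`, and closed
  exact isClosed_singleton_apply_of_image_closure_subset π hη σ σ.isClosedMap _
    (isAffineOpen_opensRange (g _ hcU)) hchart

end Main

end Summit.ResolutionOfSingularities.ResolutionOfSingularities.Theorems.NoZeno.FirstKind

end
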